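import Summits.RiemannHypothesis.RiemannHypothesis.Theses.WeilComb
import Summits.RiemannHypothesis.RiemannHypothesis.Theorems.WeilCombCombShapeAdmissible
import Literature.NumberTheory.LFunctions.WeilExplicit
import Literature.NumberTheory.LFunctions.WeilExplicitProofs
import Literature.NumberTheory.LFunctions.WeilMellinBounds
import Literature.NumberTheory.LFunctions.WeilWindowSimpleEven
import Literature.NumberTheory.LFunctions.WeilGroundEnergyProofs

/-!
# The comb symbol is real and even
(crux `WeilComb.CombShapePositivity`, item stmt-RiemannHypothesis-11229, line `Sketch`; sub-goal
`weilFunctional_translate_psi_real_even` of the Theorem-B stub `stub_window`)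

Notation: `φ₀(u) = expNegInvGlue (1 - u²)` (the route's fixed bump, a Weil test by
`weilComb_shapeBump_isWeilTest`), `φ_ε(t) = ε⁻¹ φ₀(t/ε)`, `ψ_ε = φ_ε ⋆ φ̃_ε`
(`weilConv φ_ε (weilReflect φ_ε)`), `τ_x h = weilTranslate h x = h(· − x)`, `W = weilFunctional`.
The comb symbol is `w_ε(x) = W(τ_x ψ_ε)`; by the Gram identity (`stub_gram`) comb positivity is the
positive semi-definiteness of the matrix `[w_ε(log m − log m')]`.

**Statement.** For `ε > 0` and every `x : ℝ`: `Im W(τ_x ψ_ε) = 0` and `W(τ_{−x} ψ_ε) = W(τ_x ψ_ε)`,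
i.e. the comb symbol is real and even (so the Gram matrix is real symmetric).

**Proof.**
* `φ_ε` is real-valued, hence so is the autocorrelation `ψ_ε(s) = ∫ φ_ε(u) conj φ_ε(u − s) du`
  (conjugation commutes with the Bochner integral, `integral_conj`). Autocorrelations are
  self-adjoint, `conj ψ_ε(−s) = ψ_ε(s)` (`conj_weilConv_weilReflect_neg`), so a real `ψ_ε` is even.
* Evenness of the symbol: `τ_{−x} ψ_ε = (τ_x ψ_ε)(−·)` pointwise (`ψ_ε` even), and `W` is
  reflection invariant (`weilFunctional_comp_neg`, hypothesis-free).
* Reality of the symbol: the symmetrised kernel `k = τ_x ψ_ε + τ_{−x} ψ_ε` is self-adjoint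
  (`ψ_ε` real and even), so `conj W(k) = W(k)` (`conj_weilFunctional_of_selfAdjoint`); by additivity
  of `W` on Weil tests (`weilFunctional_add`; `ψ_ε` is a test as the convolution of the test `φ_ε`
  with its reflection, and translates of tests are tests) and the evenness just proved,
  `W(k) = 2 W(τ_x ψ_ε)`, whence `conj W(τ_x ψ_ε) = W(τ_x ψ_ε)`, i.e. `Im W(τ_x ψ_ε) = 0`.
-/

noncomputable section

-- the sub-problem path RiemannHypothesis/RiemannHypothesis duplicates a namespace (D-0017)
set_option linter.dupNamespace false

open scoped BigOperators ComplexConjugate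
open Complex MeasureTheory Set

namespace Summit.RiemannHypothesis.RiemannHypothesis.Theorems.WeilCombBohrFejer

open Literature.NumberTheory.LFunctions

/-! ### Private toolkit: real autocorrelations are real and even -/

/-- `φ_ε = ε⁻¹ φ(·/ε)` is a Weil test function for `ε ≠ 0` (smoothness of `t ↦ t/ε`; the support is
the image of a compact set under the homeomorphism `t ↦ ε t`). [folklore] -/
private theorem isWeilTest_dil_symbolRealEven {φ : ℝ → ℂ} {ε : ℝ} (hφ : IsWeilTest φ)
    (hε : ε ≠ 0) : IsWeilTest (fun t : ℝ => (ε : ℂ)⁻¹ * φ (t / ε)) := by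
  -- adapted from `WeilCombBohrFejer.isWeilTest_dil` (private in the Gram-identity file)
  have h1 : IsWeilTest (fun t : ℝ => φ (t / ε)) := by
    refine ⟨hφ.1.comp (contDiff_id.div_const ε), ?_⟩
    have e : (fun t : ℝ => φ (t / ε)) = φ ∘ (Homeomorph.mulRight₀ ε⁻¹ (inv_ne_zero hε)) := by
      ext t
      simp [div_eq_mul_inv]
    rw [e]
    exact hφ.2.comp_homeomorph _
  exact h1.const_mul _

/-- The autocorrelation `φ ⋆ φ̃` of a real-valued `φ` is real-valued:
`conj (φ ⋆ φ̃)(s) = ∫ conj φ(u) · φ(u − s) du = (φ ⋆ φ̃)(s)` (`integral_conj`; no hypotheses beyond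
reality, both sides carrying the same junk value). [folklore] -/
private theorem conj_weilConv_weilReflect_of_real {φ : ℝ → ℂ} (hreal : ∀ t, conj (φ t) = φ t)
    (s : ℝ) : conj (weilConv φ (weilReflect φ) s) = weilConv φ (weilReflect φ) s := by
  rw [weilConv_apply, ← integral_conj]
  congr 1 with u
  simp only [weilReflect, map_mul, hreal]

/-- The autocorrelation `φ ⋆ φ̃` of a real-valued `φ` is even: it is real
(`conj_weilConv_weilReflect_of_real`) and self-adjoint (`conj_weilConv_weilReflect_neg`). [folklore] -/
private theorem weilConv_weilReflect_neg_of_real {φ : ℝ → ℂ} (hreal : ∀ t, conj (φ t) = φ t)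
    (s : ℝ) : weilConv φ (weilReflect φ) (-s) = weilConv φ (weilReflect φ) s := by
  rw [← conj_weilConv_weilReflect_of_real hreal (-s)]
  exact conj_weilConv_weilReflect_neg φ s

/-- For an even kernel `ψ`, the translate by `−x` is the reflection of the translate by `x`:
`τ_{−x} ψ = (τ_x ψ)(−·)` (`ψ(t + x) = ψ(−t − x)`). [folklore] -/
private theorem weilTranslate_neg_of_even {ψ : ℝ → ℂ} (heven : ∀ s, ψ (-s) = ψ s) (x : ℝ) :
    weilTranslate ψ (-x) = fun t => weilTranslate ψ x (-t) := by
  funext t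
  simp only [weilTranslate]
  rw [← heven (t - -x)]
  congr 1
  ring

/-- For an even kernel `ψ`, `W(τ_{−x} ψ) = W(τ_x ψ)` (`τ_{−x} ψ = (τ_x ψ)(−·)` and the
hypothesis-free reflection invariance `weilFunctional_comp_neg`). [folklore] -/
private theorem weilFunctional_weilTranslate_neg_of_even {ψ : ℝ → ℂ} (heven : ∀ s, ψ (-s) = ψ s)
    (x : ℝ) : weilFunctional (weilTranslate ψ (-x)) = weilFunctional (weilTranslate ψ x) := by
  rw [weilTranslate_neg_of_even heven, weilFunctional_comp_neg]

/-- For a real and even Weil test `ψ`, `W(τ_x ψ)` is self-conjugate: the symmetrised kernel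
`τ_x ψ + τ_{−x} ψ` is self-adjoint, so its `W` is self-conjugate
(`conj_weilFunctional_of_selfAdjoint`), and `W(τ_x ψ + τ_{−x} ψ) = 2 W(τ_x ψ)` by additivity on
tests (`weilFunctional_add`) and `weilFunctional_weilTranslate_neg_of_even`. [folklore] -/
private theorem conj_weilFunctional_weilTranslate_of_real_even {ψ : ℝ → ℂ} (hψ : IsWeilTest ψ)
    (hreal : ∀ s, conj (ψ s) = ψ s) (heven : ∀ s, ψ (-s) = ψ s) (x : ℝ) :
    conj (weilFunctional (weilTranslate ψ x)) = weilFunctional (weilTranslate ψ x) := by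
  have hsa : ∀ t, conj ((weilTranslate ψ x + weilTranslate ψ (-x)) (-t)) =
      (weilTranslate ψ x + weilTranslate ψ (-x)) t := by
    intro t
    simp only [Pi.add_apply, weilTranslate, map_add, hreal]
    rw [show -t - x = -(t - -x) by ring, heven, show -t - -x = -(t - x) by ring, heven, add_comm]
  have h := conj_weilFunctional_of_selfAdjoint hsa
  rw [weilFunctional_add (hψ.weilTranslate x) (hψ.weilTranslate (-x)),
    weilFunctional_weilTranslate_neg_of_even heven, map_add] at h
  linear_combination (1 / 2 : ℂ) * h

/-- For a real-valued Weil test `φ` and `ψ = φ ⋆ φ̃`: `Im W(τ_x ψ) = 0` and `W(τ_{−x} ψ) = W(τ_x ψ)`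
(the symbol `x ↦ W(τ_x ψ)` is real and even). [folklore] -/
private theorem weilFunctional_weilTranslate_autocorr_real_even {φ : ℝ → ℂ} (hφ : IsWeilTest φ)
    (hreal : ∀ t, conj (φ t) = φ t) (x : ℝ) :
    (weilFunctional (weilTranslate (weilConv φ (weilReflect φ)) x)).im = 0 ∧
    weilFunctional (weilTranslate (weilConv φ (weilReflect φ)) (-x)) =
      weilFunctional (weilTranslate (weilConv φ (weilReflect φ)) x) := by
  have hψ : IsWeilTest (weilConv φ (weilReflect φ)) := hφ.weilConv hφ.weilReflect
  have hψreal := conj_weilConv_weilReflect_of_real hreal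
  have hψeven := weilConv_weilReflect_neg_of_real hreal
  exact ⟨Complex.conj_eq_iff_im.1
      (conj_weilFunctional_weilTranslate_of_real_even hψ hψreal hψeven x),
    weilFunctional_weilTranslate_neg_of_even hψeven x⟩

/-! ### The sub-goal -/

/-- **Sub-goal (ii) of `stub_window` — the comb symbol is real and even.** For `ε > 0` and
`ψ_ε = φ_ε ⋆ φ̃_ε`, `φ_ε(t) = ε⁻¹ expNegInvGlue (1 − (t/ε)²)`: `Im W(τ_x ψ_ε) = 0` and
`W(τ_{−x} ψ_ε) = W(τ_x ψ_ε)` for every `x : ℝ` (so the Gram matrix `[W(τ_{log m − log m'} ψ_ε)]`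
of the comb is real symmetric). [folklore] -/
theorem weilFunctional_translate_psi_real_even : ∀ ε : ℝ, 0 < ε → ∀ x : ℝ,
    (weilFunctional (weilTranslate
        (weilConv (fun t : ℝ => (ε : ℂ)⁻¹ * ((expNegInvGlue (1 - (t / ε) ^ 2) : ℝ) : ℂ))
          (weilReflect (fun t : ℝ => (ε : ℂ)⁻¹ * ((expNegInvGlue (1 - (t / ε) ^ 2) : ℝ) : ℂ)))) x)).im = 0 ∧
    weilFunctional (weilTranslate
        (weilConv (fun t : ℝ => (ε : ℂ)⁻¹ * ((expNegInvGlue (1 - (t / ε) ^ 2) : ℝ) : ℂ))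
          (weilReflect (fun t : ℝ => (ε : ℂ)⁻¹ * ((expNegInvGlue (1 - (t / ε) ^ 2) : ℝ) : ℂ)))) (-x)) =
      weilFunctional (weilTranslate
        (weilConv (fun t : ℝ => (ε : ℂ)⁻¹ * ((expNegInvGlue (1 - (t / ε) ^ 2) : ℝ) : ℂ))
          (weilReflect (fun t : ℝ => (ε : ℂ)⁻¹ * ((expNegInvGlue (1 - (t / ε) ^ 2) : ℝ) : ℂ)))) x) := by
  intro ε hε x
  -- the fixed bump `φ₀` is a Weil test, hence so is `φ_ε`
  have hφ : IsWeilTest (fun u : ℝ => ((expNegInvGlue (1 - u ^ 2) : ℝ) : ℂ)) :=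
    Summit.RiemannHypothesis.RiemannHypothesis.Theorems.weilComb_shapeBump_isWeilTest
  have hdil : IsWeilTest (fun t : ℝ => (ε : ℂ)⁻¹ * ((expNegInvGlue (1 - (t / ε) ^ 2) : ℝ) : ℂ)) :=
    isWeilTest_dil_symbolRealEven hφ hε.ne'
  -- `φ_ε` is real-valued
  have hreal : ∀ t : ℝ,
      conj ((ε : ℂ)⁻¹ * ((expNegInvGlue (1 - (t / ε) ^ 2) : ℝ) : ℂ)) =
        (ε : ℂ)⁻¹ * ((expNegInvGlue (1 - (t / ε) ^ 2) : ℝ) : ℂ) := by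
    intro t
    simp only [map_mul, map_inv₀, Complex.conj_ofReal]
  exact weilFunctional_weilTranslate_autocorr_real_even hdil hreal x

end Summit.RiemannHypothesis.RiemannHypothesis.Theorems.WeilCombBohrFejer

end
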